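import Summits.PneNP.PneNP.Theorems.SzkEntropyPeaWorstToAvgDualModeCompileDefs
import Literature.Computability.Complexity.PromiseBPPFromFPDecider
import Literature.Computability.Complexity.UniformProbBlocks

/-!
# Route SzkEntropy, crux `PeaWorstToAvg` (stmt-PneNP-10777), line `dual-mode-compile`: the encoded decider

Stub `stub_decider` of the skeleton `Summits/PneNP/PneNP/Cruxes/PeaWorstToAvg/Lines/dual-mode-compile.lean`
(objects: `Theorems/SzkEntropyPeaWorstToAvgDualModeCompileDefs.lean`).  A UNIFORM randomized heuristic scheme
`U(y, 1ⁿ, 1ᵐ)` (`UHeurBPP`: honest polynomial coin budget `c_U`) for the distributional problem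
`(BPEA.yes, ½ law_false + ½ law_true)` of a mode kit, together with the kit's mode-preserving `1/16`-statistical
encoder `enc`, decides `PEA 3` in textbook promise-`BPP` (`PromiseBPP'`, Goldreich 2006, Def. 1.2).

The machine (a total one-bit `FP` string function on words `⟨x, y⟩`, assembled from the tree's bricks inside
`decider_exists_machine`): read the first `encCoins(|x|)` coins `r₁` of `y`, compute `z = enc(x; r₁)`, form the
query `q = ⟨z, 1^{|x|}, 1^{256}⟩`, read the next `c_U(|q|)` coins `r₂` (computable because the budget of a UNIFORM
scheme is a polynomial — the only use of uniformity) and output `U(q; r₂)`.  ONE run suffices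
(`decider_fail_le`): on a YES instance `x` (`n = |x|`) the inputs `z` on which `U` errs with probability `≥ 1/4`
have mixture-mass `≤ 1/256`, hence `law_true`-mass `≤ 1/128`; adding the off-support strings (mass `0`) and
transporting along `enc_yes`, the draw `z ← enc x` is bad with probability `≤ 1/128 + 1/16 = 9/128`; a good `z`
lies in `supp law_true ⊆ BPEA.yes` (certificate `samp_yes`), so `U` answers `true` except with probability
`< 1/4` over ITS fresh coins (`uniformProb_block_le`).  Failure `≤ 9/128 + 1/4 = 41/128`, success
`≥ 87/128 ≥ 2/3`; NO instances symmetrically (`enc_no`, `samp_no`, `BPEA_disjoint`).  The coin polynomial is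
`encCoins + c_U ∘ G` with `G` a polynomial bound of `|q|` (output-length bound of the encoder's machine).
No definitions are introduced (the machine is a local term, as in `Theorems.exists_padded_simulator`).

References: O. Goldreich, *On promise problems: a survey*, LNCS 3895 (2006), Def. 1.2; S. Arora, B. Barak,
*Computational Complexity* (2009), Def. 7.3, §7.4.1; A. Bogdanov, L. Trevisan, *Average-Case Complexity*
(2006), Def. 2.12–2.13; J. Feigenbaum, L. Fortnow, *Random-self-reducibility of complete sets*, SIAM J.
Comput. 22 (1993) (deciding the worst case through a random self-reduction).
-/

noncomputable section

open _root_.Computability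
open Literature.Computability.Complexity Literature.Computability.MetaComplexity
open Literature.Computability.Complexity.Brick

namespace Summit.PneNP.PneNP.Cruxes.PeaWorstToAvg.DualModeCompile

set_option linter.dupNamespace false -- `Summit.PneNP.PneNP.…`: summit = sub-problem name (D-0017)

/-! ### Acceptance probabilities of one run -/

section Probability

variable {kit : ModeKit} {U : RandAlg (List Bool × ℕ × ℕ) Bool} {cU : Polynomial ℕ}

/-- Monotonicity of `uniformProb m` along inclusions checked on strings of length `m` only. [folklore] -/
private theorem uniformProb_mono_len {m : ℕ} {E E' : Set (List Bool)}
    (h : ∀ y : List Bool, y.length = m → y ∈ E → y ∈ E') : uniformProb m E ≤ uniformProb m E' := by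
  classical
  unfold uniformProb
  refine div_le_div_of_nonneg_right ?_ (by positivity)
  exact_mod_cast Finset.card_le_card fun r hr => by
    simp only [Finset.mem_filter, Finset.mem_univ, true_and] at hr ⊢
    exact h _ r.toList_length hr

/-- **Few bad draws.** If a set `Bad` has mixture-mass `≤ 1/256` at `n = |x|` and the law of `enc x` is
`1/16`-close to mode `b`, then `enc x` falls outside `G = supp (law_b n) ∖ Bad` with probability
`≤ 2/256 + 1/16 = 9/128` (`toOuterMeasure_le_two_mul_mixEnsemble`; off-support strings have mass `0`).
[cite: BogdanovTrevisan2006, Def. 2.12] -/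
theorem decider_pr_compl_good_le (b : Bool) (x : List Bool) (Bad : Set (List Bool))
    (hbad : kit.mix.prob x.length Bad ≤ 1 / 256)
    (henc : ∀ E : Set (List Bool), kit.enc.pr id x E ≤ (kit.samp b).pr unaryEncodeNat x.length E + 1 / 16) :
    kit.enc.pr id x {z | z ∈ (kit.law b x.length).support ∧ z ∉ Bad}ᶜ ≤ 9 / 128 := by
  set n := x.length with hn
  set G : Set (List Bool) := {z | z ∈ (kit.law b n).support ∧ z ∉ Bad} with hGdef
  refine (henc Gᶜ).trans ?_
  have hsub : Gᶜ ∩ (kit.law b n).support ⊆ Bad := by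
    rintro z ⟨hz, hsupp⟩
    by_contra hzb
    exact hz ⟨hsupp, hzb⟩
  have hle : (kit.law b n).toOuterMeasure Gᶜ ≤
      2 * (mixEnsemble (kit.law false) (kit.law true) n).toOuterMeasure Bad := by
    refine (PMF.toOuterMeasure_mono _ hsub).trans ?_
    have h2 := toOuterMeasure_le_two_mul_mixEnsemble (kit.law false) (kit.law true) n Bad b
    cases b <;> simpa using h2
  have hR : ((kit.law b n).toOuterMeasure Gᶜ).toReal ≤
      2 * ((mixEnsemble (kit.law false) (kit.law true) n).toOuterMeasure Bad).toReal := by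
    have := ENNReal.toReal_mono (ENNReal.mul_ne_top (by simp) (toOuterMeasure_ne_top' _ _)) hle
    rwa [ENNReal.toReal_mul, ENNReal.toReal_ofNat] at this
  have hpr : (kit.samp b).pr unaryEncodeNat n Gᶜ = ((kit.law b n).toOuterMeasure Gᶜ).toReal := rfl
  have hmix : ((mixEnsemble (kit.law false) (kit.law true) n).toOuterMeasure Bad).toReal ≤ 1 / 256 := hbad
  rw [hpr]
  linarith

/-- **Failure probability of one run** (mode `b`, instance `x`, `n = |x|`, coins `encCoins(n) + m` with `m` at
least every reachable budget `c_U(|query|)`): the output bit `U(⟨z, 1ⁿ, 1^{256}⟩; r₂)`, `z = enc(x; r₁)`, differs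
from `b` with probability `≤ 41/128` — the draw `z` is bad with probability `≤ 9/128` (`decider_pr_compl_good_le`,
read off the prefix `r₁`, `uniformProb_take_of_le`), and for a good `z` (so `[z ∈ BPEA.yes] = b` and coin error
`< 1/4`) the fresh block `r₂` errs with probability `< 1/4` (`uniformProb_block_le`); union bound.
[cite: Goldreich2006, Def. 1.2] [cite: AroraBarak2009, §7.4.1] -/
theorem decider_fail_le (hcU : ∀ ℓ, U.coinLen ℓ = cU.eval ℓ) (b : Bool) (x : List Bool)
    (hbad : kit.mix.prob x.length
      {z | 1 / 4 ≤ U.pr schemeEnc (z, x.length, 256) {c | c ≠ BPEA.yes.boolIndicator z}} ≤ 1 / 256)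
    (hmode : ∀ z ∈ (kit.law b x.length).support, BPEA.yes.boolIndicator z = b)
    (henc : ∀ E : Set (List Bool), kit.enc.pr id x E ≤ (kit.samp b).pr unaryEncodeNat x.length E + 1 / 16)
    {m : ℕ} (hm : ∀ r : List Bool, r.length = kit.encCoins.eval x.length →
      cU.eval (schemeEnc (kit.enc.run x r, x.length, 256)).length ≤ m) :
    uniformProb (kit.encCoins.eval x.length + m)
      {y | U.run (kit.enc.run x (y.take (kit.encCoins.eval x.length)), x.length, 256)
        ((y.drop (kit.encCoins.eval x.length)).take (cU.eval
          (schemeEnc (kit.enc.run x (y.take (kit.encCoins.eval x.length)), x.length, 256)).length)) ≠ b} ≤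
      41 / 128 := by
  -- notation
  set n := x.length with hn
  set a := kit.encCoins.eval n with ha
  set Bad : Set (List Bool) :=
    {z | 1 / 4 ≤ U.pr schemeEnc (z, n, 256) {c | c ≠ BPEA.yes.boolIndicator z}} with hBad
  set G : Set (List Bool) := {z | z ∈ (kit.law b n).support ∧ z ∉ Bad} with hGdef
  set ℓ : List Bool → ℕ := fun w => cU.eval (schemeEnc (kit.enc.run x w, n, 256)).length with hℓ
  -- the two failure events: a bad draw; a good draw but erring fresh coins
  set F₁ : Set (List Bool) := {y | y.take a ∈ {r : List Bool | kit.enc.run x r ∈ Gᶜ}} with hF₁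
  set B : List Bool → Set (List Bool) := fun w =>
    {u | kit.enc.run x w ∈ G ∧ U.run (kit.enc.run x w, n, 256) (u.take (ℓ w)) ≠ b} with hB
  set F₂ : Set (List Bool) := {y | (y.drop a).take m ∈ B (y.take a)} with hF₂
  -- a bad draw
  have h1 : uniformProb (a + m) F₁ ≤ 9 / 128 := by
    rw [hF₁, uniformProb_take_of_le (Nat.le_add_right a m)]
    have hpr : kit.enc.pr id x Gᶜ = uniformProb a {r : List Bool | kit.enc.run x r ∈ Gᶜ} := by
      rw [RandAlg.pr_eq_uniformProb]
      change uniformProb (kit.enc.coinLen x.length) _ = _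
      rw [kit.enc_coinLen]
    rw [← hpr]
    exact decider_pr_compl_good_le b x Bad hbad henc
  -- erring fresh coins after a good draw
  have h2 : uniformProb (a + m) F₂ ≤ 1 / 4 := by
    have hblk := uniformProb_block_le (a := a) (ℓ := m) (d := 0) B (δ := 1 / 4) fun w hw => ?_
    · have e0 : a + m + 0 = a + m := rfl
      rw [e0] at hblk
      exact hblk
    by_cases hz : kit.enc.run x w ∈ G
    · have hind : BPEA.yes.boolIndicator (kit.enc.run x w) = b := hmode _ hz.1
      have hgood : U.pr schemeEnc (kit.enc.run x w, n, 256) {c | c ≠ b} < 1 / 4 := by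
        have hnb := hz.2
        simp only [hBad, Set.mem_setOf_eq, not_le, hind] at hnb
        exact hnb
      rw [RandAlg.pr_eq_uniformProb, hcU] at hgood
      have hBw : B w = {u | u.take (ℓ w) ∈
          {r : List Bool | U.run (kit.enc.run x w, n, 256) r ∈ {c : Bool | c ≠ b}}} :=
        Set.ext fun u => ⟨fun hu => hu.2, fun hu => ⟨hz, hu⟩⟩
      rw [hBw, uniformProb_take_of_le (hm w hw)]
      exact hgood.le
    · have hBw : B w = ∅ := Set.ext fun u => ⟨fun hu => hz hu.1, fun hu => hu.elim⟩
      rw [hBw, uniformProb_empty]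
      norm_num
  -- every failing coin string is of one of the two kinds
  refine (uniformProb_mono_len (E' := F₁ ∪ F₂) fun y hy hfail => ?_).trans ?_
  · by_cases hz : kit.enc.run x (y.take a) ∈ G
    · refine Or.inr ?_
      have hdrop : (y.drop a).take m = y.drop a :=
        List.take_of_length_le (by rw [List.length_drop, hy]; omega)
      change (y.drop a).take m ∈ B (y.take a)
      rw [hdrop]
      exact ⟨hz, hfail⟩
    · exact Or.inl hz
  calc uniformProb (a + m) (F₁ ∪ F₂)
      ≤ uniformProb (a + m) F₁ + uniformProb (a + m) F₂ := uniformProb_union_le _ _ _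
    _ ≤ 9 / 128 + 1 / 4 := add_le_add h1 h2
    _ = 41 / 128 := by norm_num

/-- **Success probability of one run**: the output bit equals the mode `b` with probability
`≥ 1 - 41/128 = 87/128 ≥ 2/3`. [cite: Goldreich2006, Def. 1.2] -/
theorem decider_success (hcU : ∀ ℓ, U.coinLen ℓ = cU.eval ℓ) (b : Bool) (x : List Bool)
    (hbad : kit.mix.prob x.length
      {z | 1 / 4 ≤ U.pr schemeEnc (z, x.length, 256) {c | c ≠ BPEA.yes.boolIndicator z}} ≤ 1 / 256)
    (hmode : ∀ z ∈ (kit.law b x.length).support, BPEA.yes.boolIndicator z = b)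
    (henc : ∀ E : Set (List Bool), kit.enc.pr id x E ≤ (kit.samp b).pr unaryEncodeNat x.length E + 1 / 16)
    {m : ℕ} (hm : ∀ r : List Bool, r.length = kit.encCoins.eval x.length →
      cU.eval (schemeEnc (kit.enc.run x r, x.length, 256)).length ≤ m) :
    (2 / 3 : ℝ) ≤ uniformProb (kit.encCoins.eval x.length + m)
      {y | U.run (kit.enc.run x (y.take (kit.encCoins.eval x.length)), x.length, 256)
        ((y.drop (kit.encCoins.eval x.length)).take (cU.eval
          (schemeEnc (kit.enc.run x (y.take (kit.encCoins.eval x.length)), x.length, 256)).length)) = b} := by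
  have hfail := decider_fail_le hcU b x hbad hmode henc hm
  have hc : {y : List Bool | U.run (kit.enc.run x (y.take (kit.encCoins.eval x.length)), x.length, 256)
        ((y.drop (kit.encCoins.eval x.length)).take (cU.eval
          (schemeEnc (kit.enc.run x (y.take (kit.encCoins.eval x.length)), x.length, 256)).length)) = b} =
      {y : List Bool | U.run (kit.enc.run x (y.take (kit.encCoins.eval x.length)), x.length, 256)
        ((y.drop (kit.encCoins.eval x.length)).take (cU.eval
          (schemeEnc (kit.enc.run x (y.take (kit.encCoins.eval x.length)), x.length, 256)).length)) ≠ b}ᶜ := by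
    ext y
    simp
  rw [hc, uniformProb_compl]
  linarith

end Probability

/-! ### The machine -/

/-- The run map of a randomized string map, read through the pair decoder (`w ↦ R(⟨w⟩₁; ⟨w⟩₂)`), is a total
`FP` function for a probabilistic polynomial-time `R` (compose the machine of `R` with the normaliser
`w ↦ ⟨⟨w⟩₁, ⟨w⟩₂⟩`, `PolyTimeComputable.comp_holds`). [cite: AroraBarak2009, §1.3] -/
theorem decider_runPair_mem_FP {R : RandAlg (List Bool) (List Bool)}
    (hR : R.IsPolyTime (id : List Bool → List Bool) (id : List Bool → List Bool)) :
    (fun w => R.run (fstF w) (sndF w)) ∈ FP := by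
  have hN : PolyTimeComputable (id : List Bool → List Bool)
      (fun p : List Bool × List Bool => boolPair (id p.1) p.2) (fun w => (fstF w, sndF w)) :=
    PolyTimeComputable.of_encode_eq (f := fanoutFn fstF sndF) (ea := id) (eb := id)
      id (fun _ => rfl) (fun w => by simp only [id, fanoutFn_apply])
      (fanoutFn_mem_FP fstF_mem_FP sndF_mem_FP)
  exact PolyTimeComputable.comp_holds hR.1 hN

/-- The run map of a heuristic scheme as a total one-bit string function `w ↦ [U(decScheme ⟨w⟩₁; ⟨w⟩₂)]` is
in `FP` for a probabilistic polynomial-time `U` (normalise the first component to a well-formed scheme word,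
`normScheme`, then run the machine of `U`). [cite: AroraBarak2009, §1.3] [cite: BogdanovTrevisan2006, Def. 2.12] -/
theorem decider_runScheme_mem_FP {U : RandAlg (List Bool × ℕ × ℕ) Bool}
    (hU : U.IsPolyTime schemeEnc encodeBool) :
    (fun w => encodeBool (U.run (decScheme (fstF w)) (sndF w))) ∈ FP := by
  have hN : PolyTimeComputable (id : List Bool → List Bool)
      (fun p : (List Bool × ℕ × ℕ) × List Bool => boolPair (schemeEnc p.1) p.2)
      (fun w => (decScheme (fstF w), sndF w)) :=
    PolyTimeComputable.of_encode_eq (f := fanoutFn (normScheme ∘ fstF) sndF) (ea := id) (eb := id)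
      id (fun _ => rfl)
      (fun w => by simp only [id, fanoutFn_apply, Function.comp_apply, normScheme_apply])
      (fanoutFn_mem_FP (comp_mem_FP normScheme_mem_FP fstF_mem_FP) sndF_mem_FP)
  exact PolyTimeComputable.of_encode_eq
    (f := Function.uncurry U.run ∘ fun w => (decScheme (fstF w), sndF w))
    (ea := id) (eb := encodeBool) id (fun _ => rfl) (fun _ => rfl)
    (PolyTimeComputable.comp_holds hU.1 hN)

/-- **The decider as a one-bit `FP` function.** For a mode kit, a polynomial-time scheme `U` and a polynomial
`c_U` there is a total one-bit `FP` string function whose value on `⟨x, y⟩` is `[U(⟨z, 1^{|x|}, 1^{256}⟩; r₂)]`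
with `r₁ = y ↾ encCoins(|x|)`, `z = enc(x; r₁)`, `r₂ = (y ⇂ encCoins(|x|)) ↾ c_U(|⟨z, 1^{|x|}, 1^{256}⟩|)`
(bricks `fanoutFn`, `fstF/sndF`, `onesFn`, `Plumb.takeFn/dropFn/polyFn`, the two machines).
[cite: AroraBarak2009, §1.3] [cite: Goldreich2006, Def. 1.2] -/
theorem decider_exists_machine (kit : ModeKit) {U : RandAlg (List Bool × ℕ × ℕ) Bool}
    (hU : U.IsPolyTime schemeEnc encodeBool) (cU : Polynomial ℕ) :
    ∃ dec : List Bool → List Bool, dec ∈ FP ∧ OneBit dec ∧ ∀ x y : List Bool,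
      dec (boolPair x y) = [U.run (kit.enc.run x (y.take (kit.encCoins.eval x.length)), x.length, 256)
        ((y.drop (kit.encCoins.eval x.length)).take (cU.eval
          (schemeEnc (kit.enc.run x (y.take (kit.encCoins.eval x.length)), x.length, 256)).length))] := by
  -- the stages of the machine, as total string functions
  set peF : List Bool → List Bool := Plumb.polyFn kit.encCoins ∘ fstF with hpeF
  set r1F : List Bool → List Bool := Plumb.takeFn ∘ fanoutFn peF sndF with hr1F
  set zF : List Bool → List Bool := (fun w => kit.enc.run (fstF w) (sndF w)) ∘ fanoutFn fstF r1F with hzF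
  set qF : List Bool → List Bool := fanoutFn zF (fanoutFn (onesFn ∘ fstF) fun _ => unaryEncodeNat 256)
    with hqF
  set r2F : List Bool → List Bool :=
    Plumb.takeFn ∘ fanoutFn (Plumb.polyFn cU ∘ qF) (Plumb.dropFn ∘ fanoutFn peF sndF) with hr2F
  set dec : List Bool → List Bool :=
    (fun w => encodeBool (U.run (decScheme (fstF w)) (sndF w))) ∘ fanoutFn qF r2F with hdec
  refine ⟨dec, ?_, fun _ => ⟨_, rfl⟩, fun x y => ?_⟩
  · -- closure of `FP` under composition and fan-out
    have hpe : peF ∈ FP := comp_mem_FP (Plumb.polyFn_mem_FP _) fstF_mem_FP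
    have hr1 : r1F ∈ FP := comp_mem_FP Plumb.takeFn_mem_FP (fanoutFn_mem_FP hpe sndF_mem_FP)
    have hz : zF ∈ FP :=
      comp_mem_FP (decider_runPair_mem_FP kit.enc_polyTime) (fanoutFn_mem_FP fstF_mem_FP hr1)
    have hq : qF ∈ FP :=
      fanoutFn_mem_FP hz (fanoutFn_mem_FP (comp_mem_FP onesFn_mem_FP fstF_mem_FP) (const_mem_FP _))
    have hr2 : r2F ∈ FP :=
      comp_mem_FP Plumb.takeFn_mem_FP (fanoutFn_mem_FP (comp_mem_FP (Plumb.polyFn_mem_FP cU) hq)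
        (comp_mem_FP Plumb.dropFn_mem_FP (fanoutFn_mem_FP hpe sndF_mem_FP)))
    exact comp_mem_FP (decider_runScheme_mem_FP hU) (fanoutFn_mem_FP hq hr2)
  · -- the value on a pair
    have hpe : peF (boolPair x y) = ones (kit.encCoins.eval x.length) := by
      simp only [hpeF, Function.comp_apply, fstF_boolPair, Plumb.polyFn_apply]
    have hr1 : r1F (boolPair x y) = y.take (kit.encCoins.eval x.length) := by
      simp only [hr1F, Function.comp_apply, fanoutFn_apply, hpe, sndF_boolPair, Plumb.takeFn_boolPair,
        List.length_replicate]
    have hz : zF (boolPair x y) = kit.enc.run x (y.take (kit.encCoins.eval x.length)) := by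
      simp only [hzF, Function.comp_apply, fanoutFn_apply, fstF_boolPair, sndF_boolPair, hr1]
    have hq : qF (boolPair x y) =
        schemeEnc (kit.enc.run x (y.take (kit.encCoins.eval x.length)), x.length, 256) := by
      simp only [hqF, fanoutFn_apply, Function.comp_apply, fstF_boolPair, hz]
      rfl
    have hr2 : r2F (boolPair x y) = (y.drop (kit.encCoins.eval x.length)).take (cU.eval
        (schemeEnc (kit.enc.run x (y.take (kit.encCoins.eval x.length)), x.length, 256)).length) := by
      simp only [hr2F, Function.comp_apply, fanoutFn_apply, hq, hpe, sndF_boolPair, Plumb.takeFn_boolPair,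
        Plumb.dropFn_boolPair, Plumb.polyFn_apply, List.length_replicate]
    simp only [hdec, Function.comp_apply, fanoutFn_apply, fstF_boolPair, sndF_boolPair, hq, hr2,
      decScheme_schemeEnc]
    rfl

/-! ### The stub -/

/-- **STUB 4 · `stub_decider`** (the encoded decider).  A uniform heuristic scheme `U` for
`(BPEA.yes, ½ law_false + ½ law_true)` (the kit's certified laws) decides `PEA 3` in textbook `PromiseBPP'`:
on `x`, draw `z ← enc x` (first `encCoins(|x|)` coins), run `U(z, 1^{|x|}, 1^{256})` on the next
`c_U(|⟨z, 1^{|x|}, 1^{256}⟩|)` coins (computable: the budget of a UNIFORM scheme is a polynomial), output its bit.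
On a YES instance the bad set of `U` has mixture-mass `≤ 1/256`, hence `law_true`-mass `≤ 1/128`; off-support
strings have `law_true`-mass `0`; by `enc_yes` the draw avoids both except with probability `≤ 1/128 + 1/16`,
and then `z ∈ BPEA.yes` (certificate `samp_yes`) so `U` answers `true` with probability `> 3/4`: success
`≥ 87/128 ≥ 2/3`; symmetrically on NO instances (`enc_no`, `samp_no`, `BPEA_disjoint`).  The coin polynomial is
`encCoins + c_U ∘ G`, `G` a polynomial bound of the query length (output-length bound of the encoder's
machine), and the predicate `(x, coins) ↦ answer` is a one-bit `FP` function (`decider_exists_machine`,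
`PromiseProblem.mem_PromiseBPP'_of_fp_decider`). [cite: Goldreich2006, Def. 1.2]
[cite: AroraBarak2009, Def. 7.3] [cite: BogdanovTrevisan2006, Def. 2.12–2.13] -/
theorem stub_decider (kit : ModeKit) (h : (⟨BPEA.yes, kit.mix⟩ : DistProblem) ∈ UHeurBPP) :
    PEA 3 ∈ PromiseBPP' := by
  obtain ⟨U, hU, ⟨cU, hcU⟩, hbad⟩ := h
  obtain ⟨dec, hdec, h1, hval⟩ := decider_exists_machine kit hU cU
  -- a polynomial bound `G(|x|)` of the query length `|⟨z, 1^{|x|}, 1^{256}⟩|` over all reachable `z`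
  obtain ⟨s, hs⟩ := exists_poly_length_le_of_mem_FP (decider_runPair_mem_FP kit.enc_polyTime)
  set G : Polynomial ℕ :=
    2 * s.comp (2 * Polynomial.X + 2 + kit.encCoins) + 2 * Polynomial.X + 260 with hGdef
  have hG : ∀ x r : List Bool, r.length = kit.encCoins.eval x.length →
      cU.eval (schemeEnc (kit.enc.run x r, x.length, 256)).length ≤ cU.eval (G.eval x.length) := by
    intro x r hr
    refine TM2Iter.eval_mono cU ?_
    have hzr := hs (boolPair x r)
    simp only [fstF_boolPair, sndF_boolPair, length_boolPair, hr] at hzr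
    have hGe : G.eval x.length =
        2 * s.eval (2 * x.length + 2 + kit.encCoins.eval x.length) + 2 * x.length + 260 := by
      simp only [hGdef, Polynomial.eval_add, Polynomial.eval_mul, Polynomial.eval_comp, Polynomial.eval_X,
        Polynomial.eval_ofNat]
    rw [length_schemeEnc, hGe]
    omega
  -- the bad sets of `U` at failure parameter `1/256`
  have hbad' : ∀ x : List Bool, kit.mix.prob x.length
      {z | 1 / 4 ≤ U.pr schemeEnc (z, x.length, 256) {c | c ≠ BPEA.yes.boolIndicator z}} ≤ 1 / 256 := by
    intro x
    have h256 := hbad x.length 256 (by norm_num)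
    have e : (1 : ℝ) / ((256 : ℕ) : ℝ) = 1 / 256 := by norm_num
    rw [e] at h256
    exact h256
  refine PromiseProblem.mem_PromiseBPP'_of_fp_decider (PEA 3) hdec h1 (kit.encCoins + cU.comp G)
    (fun x hx => ?_) (fun x hx => ?_)
  · simp only [hval, List.cons.injEq, and_true, Polynomial.eval_add, Polynomial.eval_comp]
    exact decider_success hcU true x (hbad' x)
      (fun z hz => (Set.mem_iff_boolIndicator _ _).1 (kit.samp_yes _ z hz)) (kit.enc_yes x hx) (hG x)
  · simp only [hval, List.cons.injEq, and_true, Polynomial.eval_add, Polynomial.eval_comp]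
    exact decider_success hcU false x (hbad' x)
      (fun z hz => (Set.notMem_iff_boolIndicator _ _).1
        (fun hy => Set.disjoint_left.1 BPEA_disjoint hy (kit.samp_no _ z hz))) (kit.enc_no x hx) (hG x)

end Summit.PneNP.PneNP.Cruxes.PeaWorstToAvg.DualModeCompile

end
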